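import Summits.QuantumFields.YangMills.Theses.UnitScaleTilt
import Summits.QuantumFields.YangMills.Theorems.UnitScaleTiltHistoryTailStokesIter
import Summits.QuantumFields.YangMills.Theorems.UnitScaleTiltHistoryTailBoundedHeight

/-!
# Route `UnitScaleTilt` — crux K2 `HistoryTail` (stmt-QuantumFields-18916): (71) FOR THE ROUTE'S AVERAGING, DETERMINISTIC CORE — a large
# block-averaged plaquette at height `j` forces fine Wilson action `≥ ¼p(g_{K−j})² − (remainder)` under it, for EVERY fine field with a regular
# averaging tower (support file; brick S3c of sub-lemma S3 of the split card)

Fleet lead `ym-ust-18916-p1` (gen 0); split card `CARD-18916-K2-split.md` (evidence #12), sub-lemma **S3**, brick **S3c** = the conclusion (71)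
p.273 of [Balaban1985UV3] («(1/g_k²) Σ_{p⊂Δ′} η⁻¹[1 − Re tr U_k(∂p)] ≥ … ≥ ¼p²(g_j)») for the ROUTE's objects: the (0.4)+`exp[mean log]`
block averaging on `SU(2)`, the thresholds `θ(i) = g_i p(g_i)` (`T3UnitScaleTilt.θBal`) and the bare couplings `β_i = L^i/γ` of the `T3Family`
schemes.  From S3b (`HistoryTailStokesIter.iter_sum_dist1_sq_le`, p442475: the iterated local Stokes–Jensen inequality along nested regions with
the marginal factor `(1+ε_s)·L` per step) and the identities `β_{K−j}θ(K−j)² = p(g_{K−j})²` (`beta_mul_θBal_sq`), `β_K = L^j β_{K−j}`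
(`HistoryTailBoundedHeight.scheme_β_add`), `1 − Re tr W = ½|W − 1|²` on `SU(2)`:

**`smallFactor_deterministic`** — for every cutoff `K`, height `j ≤ K`, plaquette `p′` of `T^{(j)}`, every fine field `U` whose averaging tower
is regular with profile `(a_s)` (as in S3b) along nested regions `R_j = {p′} ⊇ … ⊇ R_0`, and weights with `Π_{s<j}(1+ε_s) ≤ 2`:
`θ(K−j) ≤ |Ū^{j}(∂p′) − 1|  ⇒  ¼·p(g_{K−j})² − ¼·β_{K−j}·Rem ≤ β_K · Σ_{q∈R_0} (1 − Re tr U(∂q))`,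
`Rem = Σ_{s<j} Π_{s<u<j}((1+ε_u)L)·#R_{s+1}·(1+ε_s⁻¹)·(435t_s²)²` — i.e. the Gibbs weight of the fine action UNDER `p′` carries the printed small
factor `exp(−¼p(g_{K−j})²)` up to `exp(¼β_{K−j}Rem)` (the remainder is `O(g²p⁴L^{O(1)})` under print's profile (68) — sized in S3d, not here).

WHAT THIS IS NOT: the smallness hypotheses are still GLOBAL per level (localisation to «regular near p′» pending), the regularity profile of
the composite minimisers (68) is an input of mechanism A (S2/S3d), nothing of (41)/(47), nothing uses (α).
-/

noncomputable section

open scoped BigOperators Matrix.Norms.L2Operator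

namespace Summit.QuantumFields.YangMills.Theorems.HistoryTailSmallFactor

open Literature.MathematicalPhysics.QuantumFieldTheory.Balaban1983to89
open T4Continuum BlockAveraging AveragingRT ExpMeanLog BlockAveragingPlaquetteBound
open B10Eq47AxialChi (shiftN)
open T3ContinuumYM3Torus T3UnitScaleTilt T3UnitLawDensityEML
open T3FinestHeightTail (beta_mul_θBal_sq)
open Summit.QuantumFields.YangMills.Theorems.AvgActionDefect (one_sub_reTr_eq_half_dist1_sq_su2 deltaSU_fin_two)
open Summit.QuantumFields.YangMills.Theorems.HistoryTailStokesIter (iter_sum_dist1_sq_le)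
open Summit.QuantumFields.YangMills.Theorems.HistoryTailBoundedHeight (scheme_β_add θBal_nonneg')

variable (F : T3Family) {γ : ℝ}

/-- `Π_{s<j}((1+ε_s)·Λ) = (Π_{s<j}(1+ε_s))·Λ^j`. [folklore] -/
theorem prod_mul_const_eq (ε : ℕ → ℝ) (Λ : ℝ) (j : ℕ) :
    ∏ s ∈ Finset.range j, ((1 + ε s) * Λ) = (∏ s ∈ Finset.range j, (1 + ε s)) * Λ ^ j := by
  rw [Finset.prod_mul_distrib, Finset.prod_const, Finset.card_range]

/-- **(71) FOR THE ROUTE'S AVERAGING — DETERMINISTIC CORE** (`SU(2)`, `d = 3`): if the `j`-fold averaged plaquette at `p′` is `θ(K−j)`-LARGE and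
the fine field's averaging tower is regular along nested regions `R_j = {p′} ⊇ … ⊇ R_0` (profile `a_s`, weights `ε_s` with `Π(1+ε_s) ≤ 2`), then
`¼p(g_{K−j})² − ¼β_{K−j}·Rem ≤ β_K·Σ_{q∈R_0}(1 − Re tr U(∂q))` — the fine Wilson action under `p′` is at least a quarter of the printed exponent,
`β_Kθ(K−j)²L^{−j}·… = p(g_{K−j})²` by the marginal scaling of S3a/S3b. [cite: Balaban1985UV3, (69)-(71) p.273; Balaban1987RG1, (0.4) p.253] -/
theorem smallFactor_deterministic (hγ : 0 < γ) (hγ1 : γ ≤ 1) {b₀ : ℝ} (hb₀ : 0 ≤ b₀) (p₀ : ℝ) {K j : ℕ} (hjK : j ≤ K)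
    (p' : Plaq (F.P K) j) (U : GaugeField (F.P K) 0 (Matrix.specialUnitaryGroup (Fin 2) ℂ)) (a ε : ℕ → ℝ)
    (R : (s : ℕ) → Finset (Plaq (F.P K) s)) (hRj : R j = {p'})
    (ha : ∀ s, s < j → 0 ≤ a s)
    (hU : ∀ s, s < j → PlaqSmall (a s) (Averaging.iter (fun _ => BlockAveraging.blockAvg ℰp) s U))
    (ht : ∀ s, s < j → ((((3 + 2) * F.L : ℕ) : ℝ) ^ 2 / 4) * a s ≤ 1 / 10)
    (hε : ∀ s, 0 < ε s) (hprod : ∏ s ∈ Finset.range j, (1 + ε s) ≤ 2)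
    (hR : ∀ s, s < j → ∀ p ∈ R (s + 1), ∀ (r : Fin (F.P K).d → Fin (F.P K).L), ∀ t ∈ Finset.range (F.P K).L,
      ∀ s' ∈ Finset.range (F.P K).L,
        (⟨shiftN (shiftN (Site.blockSite p.src r) p.ν t) p.μ s', p.μ, p.ν, p.hμν⟩ : Plaq (F.P K) s) ∈ R s)
    (hlarge : θBal F.L γ b₀ p₀ (K - j) ≤
      dist1 (GaugeField.plaqHol (Averaging.iter (fun _ => BlockAveraging.blockAvg ℰp) j U) p')) :
    B10.pFun b₀ p₀ (Real.sqrt (γ * ((F.L : ℝ)⁻¹) ^ (K - j))) ^ 2 / 4 -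
        (F.scheme ℰp γ).β (K - j) *
          (∑ s ∈ Finset.range j, (∏ u ∈ Finset.Ico (s + 1) j, ((1 + ε u) * (F.L : ℝ))) *
            ((R (s + 1)).card * ((1 + (ε s)⁻¹) * (435 * (((((3 + 2) * F.L : ℕ) : ℝ) ^ 2 / 4) * a s) ^ 2) ^ 2))) / 4 ≤
      (F.scheme ℰp γ).β K * ∑ q ∈ R 0, (1 - reTr (GaugeField.plaqHol U q)) := by
  -- names
  set i : ℕ := K - j with hi
  have hK : K = i + j := by omega
  set θ : ℝ := θBal F.L γ b₀ p₀ i with hθ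
  set βi : ℝ := (F.scheme ℰp γ).β i with hβi
  set βK : ℝ := (F.scheme ℰp γ).β K with hβK
  set D : ℝ := ∑ q ∈ R 0, dist1 (GaugeField.plaqHol U q) ^ 2 with hD
  set Rem : ℝ := ∑ s ∈ Finset.range j, (∏ u ∈ Finset.Ico (s + 1) j, ((1 + ε u) * (F.L : ℝ))) *
      ((R (s + 1)).card * ((1 + (ε s)⁻¹) * (435 * (((((3 + 2) * F.L : ℕ) : ℝ) ^ 2 / 4) * a s) ^ 2) ^ 2)) with hRem
  have hL1 : (1 : ℝ) ≤ F.L := by exact_mod_cast F.hL.2.le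
  have hL0 : (0 : ℝ) < F.L := by positivity
  have hβi0 : 0 ≤ βi := F.scheme_β_nonneg ℰp hγ.le i
  have hβK_eq : βK = (F.L : ℝ) ^ j * βi := by rw [hβK, hK, scheme_β_add]
  have hθ0 : 0 ≤ θ := θBal_nonneg' F hγ hγ1 hb₀ p₀ i
  have hβθ : βi * θ ^ 2 = B10.pFun b₀ p₀ (Real.sqrt (γ * ((F.L : ℝ)⁻¹) ^ i)) ^ 2 := beta_mul_θBal_sq F hγ b₀ p₀ i
  -- `Λ = L⁴/L³ = L` on the route's lattices
  have hd : (F.P K).d = 3 := rfl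
  have hΛ : ((F.P K).L : ℝ) ^ 4 * (((F.P K).L : ℝ) ^ (F.P K).d)⁻¹ = F.L := by
    rw [hd]; show (F.L : ℝ) ^ 4 * ((F.L : ℝ) ^ 3)⁻¹ = F.L; field_simp
  -- S3b along the regions (δ₂ = 1/3 > 1/10 ≥ t_s)
  have hδ : ∀ s, s < j → (((((F.P K).d + 2) * (F.P K).L : ℕ) : ℝ) ^ 2 / 4) * a s < deltaSU (Fin 2) := by
    intro s hs; rw [deltaSU_fin_two]; exact (ht s hs).trans_lt (by norm_num)
  have hjmK : j ≤ (F.P K).m + (F.P K).K := by show j ≤ F.m + K; omega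
  have hS3b := iter_sum_dist1_sq_le (n := Fin 2) U a ε R j hjmK ha hU ht hδ hε hR
  rw [hRj, Finset.sum_singleton, hΛ, prod_mul_const_eq] at hS3b
  -- read the S3b bound in this file's abbreviations (`(F.P K).d = 3`, `(F.P K).L = F.L` definitionally)
  have hS3b' : dist1 (GaugeField.plaqHol (Averaging.iter (fun _ => BlockAveraging.blockAvg ℰp) j U) p') ^ 2 ≤
      (∏ s ∈ Finset.range j, (1 + ε s)) * (F.L : ℝ) ^ j * D + Rem := hS3b
  -- `θ² ≤ |Ū^{j}(∂p′) − 1|² ≤ 2·L^j·D + Rem`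
  have hsq : θ ^ 2 ≤ dist1 (GaugeField.plaqHol (Averaging.iter (fun _ => BlockAveraging.blockAvg ℰp) j U) p') ^ 2 :=
    pow_le_pow_left₀ hθ0 hlarge 2
  have hD0 : 0 ≤ D := Finset.sum_nonneg fun q _ => sq_nonneg _
  have hLj0 : 0 ≤ (F.L : ℝ) ^ j := by positivity
  have hmain : θ ^ 2 ≤ 2 * (F.L : ℝ) ^ j * D + Rem := by
    refine hsq.trans (hS3b'.trans ?_)
    have : (∏ s ∈ Finset.range j, (1 + ε s)) * (F.L : ℝ) ^ j * D ≤ 2 * (F.L : ℝ) ^ j * D :=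
      mul_le_mul_of_nonneg_right (mul_le_mul_of_nonneg_right hprod hLj0) hD0
    linarith [this]
  -- multiply by `β_{K−j}`: `p² ≤ 2·β_K·D + β_{K−j}·Rem`, and `D = 2·Σ(1 − Re tr)`
  have hmul : βi * θ ^ 2 ≤ 2 * βK * D + βi * Rem := by
    have := mul_le_mul_of_nonneg_left hmain hβi0
    rw [hβK_eq]; linarith [this]
  have hDsum : D = 2 * ∑ q ∈ R 0, (1 - reTr (GaugeField.plaqHol U q)) := by
    rw [hD, Finset.mul_sum]
    exact Finset.sum_congr rfl fun q _ => by rw [one_sub_reTr_eq_half_dist1_sq_su2]; ring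
  rw [hβθ, hDsum] at hmul
  linarith [hmul]

/-- **(71) DETERMINISTIC CORE WITH THE LEADING CONSTANT EXPOSED**: same hypotheses with an arbitrary bound `Π_{s<j}(1+ε_s) ≤ Pm`, conclusion
`(p(g_{K−j})² − β_{K−j}·Rem)/(2Pm) ≤ β_K·Σ_{q∈R_0}(1 − Re tr U(∂q))` — with `Pm ≤ 1 + η`, `β_{K−j}Rem ≤ ηp²` and `η ≤ ⅓` this is print's
`¼p(g)²` EXACTLY (leading `½` from `1 − Re tr = ½|·−1|²`, degraded to `¼` by the remainders, as in (71): «≥ ½… − O(1)g p³ ≥ ¼p²»).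
[cite: Balaban1985UV3, (69)-(71) p.273] -/
theorem smallFactor_deterministic' (hγ : 0 < γ) (hγ1 : γ ≤ 1) {b₀ : ℝ} (hb₀ : 0 ≤ b₀) (p₀ : ℝ) {K j : ℕ} (hjK : j ≤ K)
    (p' : Plaq (F.P K) j) (U : GaugeField (F.P K) 0 (Matrix.specialUnitaryGroup (Fin 2) ℂ)) (a ε : ℕ → ℝ)
    (R : (s : ℕ) → Finset (Plaq (F.P K) s)) (hRj : R j = {p'})
    (ha : ∀ s, s < j → 0 ≤ a s)
    (hU : ∀ s, s < j → PlaqSmall (a s) (Averaging.iter (fun _ => BlockAveraging.blockAvg ℰp) s U))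
    (ht : ∀ s, s < j → ((((3 + 2) * F.L : ℕ) : ℝ) ^ 2 / 4) * a s ≤ 1 / 10)
    (hε : ∀ s, 0 < ε s) {Pm : ℝ} (hprod : ∏ s ∈ Finset.range j, (1 + ε s) ≤ Pm)
    (hR : ∀ s, s < j → ∀ p ∈ R (s + 1), ∀ (r : Fin (F.P K).d → Fin (F.P K).L), ∀ t ∈ Finset.range (F.P K).L,
      ∀ s' ∈ Finset.range (F.P K).L,
        (⟨shiftN (shiftN (Site.blockSite p.src r) p.ν t) p.μ s', p.μ, p.ν, p.hμν⟩ : Plaq (F.P K) s) ∈ R s)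
    (hlarge : θBal F.L γ b₀ p₀ (K - j) ≤
      dist1 (GaugeField.plaqHol (Averaging.iter (fun _ => BlockAveraging.blockAvg ℰp) j U) p')) :
    (B10.pFun b₀ p₀ (Real.sqrt (γ * ((F.L : ℝ)⁻¹) ^ (K - j))) ^ 2 -
        (F.scheme ℰp γ).β (K - j) *
          (∑ s ∈ Finset.range j, (∏ u ∈ Finset.Ico (s + 1) j, ((1 + ε u) * (F.L : ℝ))) *
            ((R (s + 1)).card * ((1 + (ε s)⁻¹) * (435 * (((((3 + 2) * F.L : ℕ) : ℝ) ^ 2 / 4) * a s) ^ 2) ^ 2)))) / (2 * Pm) ≤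
      (F.scheme ℰp γ).β K * ∑ q ∈ R 0, (1 - reTr (GaugeField.plaqHol U q)) := by
  -- names
  set i : ℕ := K - j with hi
  have hK : K = i + j := by omega
  set θ : ℝ := θBal F.L γ b₀ p₀ i with hθ
  set βi : ℝ := (F.scheme ℰp γ).β i with hβi
  set βK : ℝ := (F.scheme ℰp γ).β K with hβK
  set D : ℝ := ∑ q ∈ R 0, dist1 (GaugeField.plaqHol U q) ^ 2 with hD
  set Rem : ℝ := ∑ s ∈ Finset.range j, (∏ u ∈ Finset.Ico (s + 1) j, ((1 + ε u) * (F.L : ℝ))) *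
      ((R (s + 1)).card * ((1 + (ε s)⁻¹) * (435 * (((((3 + 2) * F.L : ℕ) : ℝ) ^ 2 / 4) * a s) ^ 2) ^ 2)) with hRem
  have hL1 : (1 : ℝ) ≤ F.L := by exact_mod_cast F.hL.2.le
  have hβi0 : 0 ≤ βi := F.scheme_β_nonneg ℰp hγ.le i
  have hβK_eq : βK = (F.L : ℝ) ^ j * βi := by rw [hβK, hK, scheme_β_add]
  have hθ0 : 0 ≤ θ := θBal_nonneg' F hγ hγ1 hb₀ p₀ i
  have hβθ : βi * θ ^ 2 = B10.pFun b₀ p₀ (Real.sqrt (γ * ((F.L : ℝ)⁻¹) ^ i)) ^ 2 := beta_mul_θBal_sq F hγ b₀ p₀ i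
  -- `1 ≤ Π(1+ε_s) ≤ Pm`
  have hP1 : 1 ≤ ∏ s ∈ Finset.range j, (1 + ε s) := by
    calc (1 : ℝ) = ∏ _s ∈ Finset.range j, (1 : ℝ) := Finset.prod_const_one.symm
      _ ≤ ∏ s ∈ Finset.range j, (1 + ε s) :=
          Finset.prod_le_prod (fun _ _ => zero_le_one) fun s _ => by linarith [hε s]
  have hPm : 0 < Pm := lt_of_lt_of_le one_pos (hP1.trans hprod)
  have hd : (F.P K).d = 3 := rfl
  have hΛ : ((F.P K).L : ℝ) ^ 4 * (((F.P K).L : ℝ) ^ (F.P K).d)⁻¹ = F.L := by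
    rw [hd]; show (F.L : ℝ) ^ 4 * ((F.L : ℝ) ^ 3)⁻¹ = F.L; field_simp
  have hδ : ∀ s, s < j → (((((F.P K).d + 2) * (F.P K).L : ℕ) : ℝ) ^ 2 / 4) * a s < deltaSU (Fin 2) := by
    intro s hs; rw [deltaSU_fin_two]; exact (ht s hs).trans_lt (by norm_num)
  have hjmK : j ≤ (F.P K).m + (F.P K).K := by show j ≤ F.m + K; omega
  have hS3b := iter_sum_dist1_sq_le (n := Fin 2) U a ε R j hjmK ha hU ht hδ hε hR
  rw [hRj, Finset.sum_singleton, hΛ, prod_mul_const_eq] at hS3b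
  have hS3b' : dist1 (GaugeField.plaqHol (Averaging.iter (fun _ => BlockAveraging.blockAvg ℰp) j U) p') ^ 2 ≤
      (∏ s ∈ Finset.range j, (1 + ε s)) * (F.L : ℝ) ^ j * D + Rem := hS3b
  have hsq : θ ^ 2 ≤ dist1 (GaugeField.plaqHol (Averaging.iter (fun _ => BlockAveraging.blockAvg ℰp) j U) p') ^ 2 :=
    pow_le_pow_left₀ hθ0 hlarge 2
  have hD0 : 0 ≤ D := Finset.sum_nonneg fun q _ => sq_nonneg _
  have hLj0 : 0 ≤ (F.L : ℝ) ^ j := by positivity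
  have hmain : θ ^ 2 ≤ Pm * (F.L : ℝ) ^ j * D + Rem := by
    refine hsq.trans (hS3b'.trans ?_)
    have : (∏ s ∈ Finset.range j, (1 + ε s)) * (F.L : ℝ) ^ j * D ≤ Pm * (F.L : ℝ) ^ j * D :=
      mul_le_mul_of_nonneg_right (mul_le_mul_of_nonneg_right hprod hLj0) hD0
    linarith [this]
  have hmul : βi * θ ^ 2 ≤ Pm * βK * D + βi * Rem := by
    have := mul_le_mul_of_nonneg_left hmain hβi0
    rw [hβK_eq]; linarith [this]
  have hDsum : D = 2 * ∑ q ∈ R 0, (1 - reTr (GaugeField.plaqHol U q)) := by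
    rw [hD, Finset.mul_sum]
    exact Finset.sum_congr rfl fun q _ => by rw [one_sub_reTr_eq_half_dist1_sq_su2]; ring
  rw [hβθ, hDsum] at hmul
  rw [div_le_iff₀ (by positivity)]
  linarith [hmul]

end Summit.QuantumFields.YangMills.Theorems.HistoryTailSmallFactor

end
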